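import Literature.Topology.CoveringSpaces.CoveringIdRigidCenter
import Literature.Topology.CoveringSpaces.CoveringHomeomorphTransfer
import Mathlib.Topology.Compactification.OnePoint.Basic
import Literature.Topology.PlaneTopology.OnePointInversion
import HarnessLib

/-!
# Id-rigidity of the categories of covering spaces of `ℙ¹(ℂ) ∖ S` (`∞ ∈ S`, `3 ≤ |S| < ∞`):
# the tripod `ℙ¹ ∖ {0, 1, ∞}`

Topic `Literature/Topology/CoveringSpaces` — the projective-line model of the genus-`0` instances of
the id-rigidity capstone (abc-iut cell, campaign-L R1, GAP row G-L4t14-R1).  `ℙ¹(ℂ)` is Mathlib's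
one-point compactification `OnePoint ℂ`; for a finite `S ∋ ∞` the inclusion `ℂ ↪ ℙ¹` restricts to a
homeomorphism `ℂ ∖ (S ∩ ℂ) ≃ₜ ℙ¹ ∖ S` (`OnePoint.complHomeomorph`), along which
`CoveringHomeomorphTransfer` moves the plane theorems `Cov(Fin).isIdRigid_compl_finite`:

* **`Cov.isIdRigid_onePoint_compl`**, **`CovFin.isIdRigid_onePoint_compl`** — for `S ⊆ ℙ¹(ℂ)` finite
  with `∞ ∈ S` and `3 ≤ |S|`, the categories of all / of finite covering spaces of `ℙ¹ ∖ S` are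
  id-rigid;
* **`Cov.isIdRigid_tripod`**, **`CovFin.isIdRigid_tripod`** — the tripod `ℙ¹ ∖ {0, 1, ∞}`.

(The normalisation `∞ ∈ S` is harmless — a Möbius transformation moves any point of `S` to `∞` —
but Mathlib does not yet topologise the `GL₂`-action on `OnePoint K`; the general finite `S` is left
to a sequel.)  Everything is proved; one definition (`OnePoint.complHomeomorph`), no instances, no
named facts.

## References

* S. Mochizuki, *Topics in Absolute Anabelian Geometry III*, Proposition 4.2 (i) p. 106 (and the
  tripod throughout [IUTchI–IV]). [MochizukiAbsTopIII2015]
* A. Hatcher, *Algebraic Topology*, CUP 2002, §1.3. [HatcherAT2002]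
-/

noncomputable section

open CategoryTheory Set Topology OnePoint
open Literature.AnabelianGeometry.AbsoluteAnabelian (IsIdRigid)

universe u

namespace Literature.Topology.CoveringSpaces

/-! ### `ℙ¹ ∖ S ≃ₜ ℂ ∖ (S ∩ ℂ)` for `∞ ∈ S` -/

/-- **For `∞ ∈ S`, the inclusion `X ↪ OnePoint X` restricts to a homeomorphism
`X ∖ (S ∩ X) ≃ₜ (OnePoint X) ∖ S`** (an open embedding onto its image, which is all of `Sᶜ` since
`∞ ∈ S`). [cite: HatcherAT2002, §1.3 p.67] -/
def _root_.OnePoint.complHomeomorph {X : Type u} [TopologicalSpace X] (S : Set (OnePoint X))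
    (hS : ∞ ∈ S) : ↥(((↑) : X → OnePoint X) ⁻¹' S)ᶜ ≃ₜ ↥Sᶜ :=
  ((OnePoint.isOpenEmbedding_coe (X := X)).isEmbedding.restrictPreimage Sᶜ).toHomeomorphOfSurjective
    (by
      rintro ⟨b, hb⟩
      have hb' : b ≠ ∞ := fun h ↦ hb (h ▸ hS)
      obtain ⟨y, rfl⟩ := (OnePoint.ne_infty_iff_exists (x := b)).1 hb'
      exact ⟨⟨y, hb⟩, rfl⟩)

/-- The finite part `S ∩ X` of a finite `S ⊆ OnePoint X` is finite. [cite: HatcherAT2002, §1.3 p.67] -/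
theorem finite_preimage_coe_onePoint {X : Type u} {S : Set (OnePoint X)} (hS : S.Finite) :
    (((↑) : X → OnePoint X) ⁻¹' S).Finite :=
  hS.preimage OnePoint.coe_injective.injOn

/-- For `∞ ∈ S` finite, `|S ∩ X| = |S| - 1`. [cite: HatcherAT2002, §1.3 p.67] -/
theorem ncard_preimage_coe_onePoint {X : Type u} {S : Set (OnePoint X)} (hS : S.Finite) (h : ∞ ∈ S) :
    (((↑) : X → OnePoint X) ⁻¹' S).ncard + 1 = S.ncard := by
  have hpre : ((↑) : X → OnePoint X) ⁻¹' S = ((↑) : X → OnePoint X) ⁻¹' (S \ {∞}) := by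
    ext x
    simp only [mem_preimage, mem_sdiff, mem_singleton_iff, OnePoint.coe_ne_infty, not_false_eq_true,
      and_true]
  rw [hpre, ncard_preimage_of_injective_subset_range OnePoint.coe_injective (fun b hb ↦
    OnePoint.ne_infty_iff_exists.1 hb.2), ncard_sdiff_singleton_add_one h hS]

/-! ### `ℙ¹(ℂ) ∖ S` -/

/-- **The category of ALL covering spaces of `ℙ¹(ℂ) ∖ S` is id-rigid** for `S` finite, `∞ ∈ S`,
`3 ≤ |S|` (homeomorphic to `ℂ ∖ (S ∩ ℂ)` with `2 ≤ |S ∩ ℂ|`).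
[cite: MochizukiAbsTopIII2015, Proposition 4.2 (i) p.106] -/
theorem Cov.isIdRigid_onePoint_compl {S : Set (OnePoint ℂ)} (hS : S.Finite) (h : ∞ ∈ S)
    (h3 : 3 ≤ S.ncard) : IsIdRigid (Cov ↥Sᶜ) := by
  have h2 : 2 ≤ (((↑) : ℂ → OnePoint ℂ) ⁻¹' S).ncard := by
    have := ncard_preimage_coe_onePoint hS h
    omega
  exact (Cov.isIdRigid_iff_of_homeomorph (OnePoint.complHomeomorph S h)).1
    (Cov.isIdRigid_compl_finite (finite_preimage_coe_onePoint hS) h2)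

/-- **The category of FINITE covering spaces of `ℙ¹(ℂ) ∖ S` is id-rigid** for `S` finite, `∞ ∈ S`,
`3 ≤ |S|`. [cite: MochizukiAbsTopIII2015, Proposition 4.2 (i) p.106] -/
theorem CovFin.isIdRigid_onePoint_compl {S : Set (OnePoint ℂ)} (hS : S.Finite) (h : ∞ ∈ S)
    (h3 : 3 ≤ S.ncard) : IsIdRigid (CovFin ↥Sᶜ) := by
  have h2 : 2 ≤ (((↑) : ℂ → OnePoint ℂ) ⁻¹' S).ncard := by
    have := ncard_preimage_coe_onePoint hS h
    omega
  exact (CovFin.isIdRigid_iff_of_homeomorph (OnePoint.complHomeomorph S h)).1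
    (CovFin.isIdRigid_compl_finite (finite_preimage_coe_onePoint hS) h2)

/-- The tripod's cusp set `{0, 1, ∞} ⊆ ℙ¹(ℂ)` has three elements. [cite: MochizukiAbsTopIII2015, Proposition 4.2 (i) p.106] -/
theorem ncard_tripodCusps :
    ({((0 : ℂ) : OnePoint ℂ), ((1 : ℂ) : OnePoint ℂ), ∞} : Set (OnePoint ℂ)).ncard = 3 := by
  rw [ncard_eq_three]
  exact ⟨_, _, _, fun h ↦ zero_ne_one (OnePoint.coe_injective h), OnePoint.coe_ne_infty _,
    OnePoint.coe_ne_infty _, rfl⟩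

/-- **THE TRIPOD: the category of all covering spaces of `ℙ¹(ℂ) ∖ {0, 1, ∞}` is id-rigid.**
[cite: MochizukiAbsTopIII2015, Proposition 4.2 (i) p.106] -/
theorem Cov.isIdRigid_tripod :
    IsIdRigid (Cov ↥({((0 : ℂ) : OnePoint ℂ), ((1 : ℂ) : OnePoint ℂ), ∞} : Set (OnePoint ℂ))ᶜ) :=
  Cov.isIdRigid_onePoint_compl (toFinite _) (by simp) (by rw [ncard_tripodCusps])

/-- **THE TRIPOD: the category of finite covering spaces of `ℙ¹(ℂ) ∖ {0, 1, ∞}` is id-rigid.**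
[cite: MochizukiAbsTopIII2015, Proposition 4.2 (i) p.106] -/
theorem CovFin.isIdRigid_tripod :
    IsIdRigid (CovFin ↥({((0 : ℂ) : OnePoint ℂ), ((1 : ℂ) : OnePoint ℂ), ∞} : Set (OnePoint ℂ))ᶜ) :=
  CovFin.isIdRigid_onePoint_compl (toFinite _) (by simp) (by rw [ncard_tripodCusps])

/-! ### General finite `S ⊆ ℙ¹(ℂ)`: the normalisation `∞ ∈ S` removed by a Möbius inversion -/

/-- For a finite `S ⊆ ℙ¹(𝕜)` with a point `s`, a self-homeomorphism of `ℙ¹` moving `s` to `∞`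
identifies `ℙ¹ ∖ S` with `ℙ¹ ∖ S'`, `S' ∋ ∞` of the same cardinality (`OnePointInversion`).
[cite: HatcherAT2002, §1.3 p.67] -/
theorem exists_homeomorph_compl_infty_mem {S : Set (OnePoint ℂ)} (hS : S.Nonempty) :
    ∃ (S' : Set (OnePoint ℂ)) (_ : ↥Sᶜ ≃ₜ ↥S'ᶜ), ∞ ∈ S' ∧ S'.ncard = S.ncard ∧
      (S.Finite → S'.Finite) := by
  obtain ⟨s, hs⟩ := hS
  obtain ⟨φ, hφ⟩ := OnePoint.exists_homeomorph_apply_eq_infty s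
  exact ⟨φ '' S, (φ.image Sᶜ).trans (Homeomorph.setCongr (image_compl_eq φ.bijective)),
    ⟨s, hs, hφ⟩, ncard_image_of_injective S φ.injective, fun h ↦ h.image φ⟩

/-- **The category of ALL covering spaces of `ℙ¹(ℂ) ∖ S` is id-rigid for every finite `S` with
`3 ≤ |S|`** (no normalisation). [cite: MochizukiAbsTopIII2015, Proposition 4.2 (i) p.106] -/
theorem Cov.isIdRigid_onePoint_compl_of_finite {S : Set (OnePoint ℂ)} (hS : S.Finite)
    (h3 : 3 ≤ S.ncard) : IsIdRigid (Cov ↥Sᶜ) := by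
  obtain ⟨S', e, hinf, hcard, hfin⟩ :=
    exists_homeomorph_compl_infty_mem (nonempty_of_ncard_ne_zero (by omega) : S.Nonempty)
  exact (Cov.isIdRigid_iff_of_homeomorph e).2
    (Cov.isIdRigid_onePoint_compl (hfin hS) hinf (hcard ▸ h3))

/-- **The category of FINITE covering spaces of `ℙ¹(ℂ) ∖ S` is id-rigid for every finite `S` with
`3 ≤ |S|`** — the topological shadow of [AbsTopIII] Prop. 4.2 (i) for ALL hyperbolic curves of
genus `0` over `ℂ`. [cite: MochizukiAbsTopIII2015, Proposition 4.2 (i) p.106] -/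
theorem CovFin.isIdRigid_onePoint_compl_of_finite {S : Set (OnePoint ℂ)} (hS : S.Finite)
    (h3 : 3 ≤ S.ncard) : IsIdRigid (CovFin ↥Sᶜ) := by
  obtain ⟨S', e, hinf, hcard, hfin⟩ :=
    exists_homeomorph_compl_infty_mem (nonempty_of_ncard_ne_zero (by omega) : S.Nonempty)
  exact (CovFin.isIdRigid_iff_of_homeomorph e).2
    (CovFin.isIdRigid_onePoint_compl (hfin hS) hinf (hcard ▸ h3))

end Literature.Topology.CoveringSpaces

end
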